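import Summits.BirchSwinnertonDyer.BirchSwinnertonDyer.Theorems.ManinLocalTwoThreeShimuraKernelRealStructure
import Summits.BirchSwinnertonDyer.BirchSwinnertonDyer.Theorems.ManinLocalTwoThreeThreeBlindInvariance
import HarnessLib

/-!
# (NC-b) `KummerCoverNotGammaOne` at `9 ∣ N` — the Kummer cover `Y_T → X₀(N)` of a rational `3`-torsion point is NOT a quotient of `X₁(N)`
# (route `ManinLocalTwoThree`, crux C3 `ManinPrimeToThreeAtNine` stmt-BirchSwinnertonDyer-22968; cell bsd-f2-manin, prover seat p3 gen 15 —
# node (NC-b) of -an g37's UDC line, MEMO-an §80.12, v21-draft stub 4 `stub_kummerCoverNotGammaOne`, HOME/an/g37/UDCKummerLine-an-g37.lean)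

For a LATTICE-OPTIMAL `X₀(N)`-datum `D` of a globally minimal `W` (`Λ_E = c·Λ₀(f)`), `9 ∣ N`, a rational point `(X₀, Y₀)` of order
`3` of the short model `E_{W,c}` and an analytic lift `u` (`3u ∈ Λ_E`, `c²℘(u) = X₀`; `u ∉ Λ_E` follows), the Kummer character
`χ_T : Γ₀(N) → Λ_E/(ℤ·3u + 3Λ_E) ≅ ℤ/3`, `γ ↦ c·{∞,γ∞}_f`, is NON-TRIVIAL ON `Γ₁(N)`:
**`exists_mem_gamma1_not_kummerPeriodTrivial`** — some `γ ∈ Γ₁(N)` has `c·{∞,γ∞}_f ∉ ℤ·3u + 3Λ_E`.  an's (NC-b) rates this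
«content L; engine Ling–Oesterlé 1991 / Vatsal 2005 (Σ(N) is of μ-type); beyond print as stated; kernel proof would need Stevens'
X₁(N)-parametrisation».  It does not: the LEAD's UNCONDITIONAL μ₃-type theorem `no_rational_kernel_generator` (p719340) is exactly the
needed shadow of Ling–Oesterlé.  PROOF.  If every `γ ∈ Γ₁(N)` had `c·{∞,γ∞}_f ∈ S := ℤ·3u + 3Λ_E` then `c·Λ₁(f) ⊆ S`
(`periodLatticeGamma1` is generated by these symbols).  (A) If `Λ₁(f) = Λ₀(f)` then `Λ_E = cΛ₀(f) ⊆ S`, i.e. `Λ_E/3Λ_E ≅ (ℤ/3)²` would be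
generated by the class of `3u` — impossible (`𝔽₃`-coordinates, `PeriodPair.intCast_pair_eq_zero`).  (B) If `Λ₁(f) ≠ Λ₀(f)`: `Λ₁(f) ⊄ 3Λ₀(f)`
(else complex conjugation, which acts trivially on `Λ₀/Λ₁` — p2 g9 `conj_sub_self_mem_periodLatticeGamma1` — would act trivially on
`Λ₀/3Λ₀`, excluded by the LEAD's `false_of_conj_sub_self_mem_natCast_mul`), so pick `w ∈ Λ₁(f) ∖ 3Λ₀(f)`; `cw = k·3u + 3ν` with `3 ∤ k`
(else `w ∈ 3Λ₀`), hence `cw/3 ≡ ±u (mod Λ_E)` and `℘(cw/3) = ℘(u) = X₀/c²` is the abscissa of the RATIONAL `3`-torsion point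
`(X₀/c², Y₀/c³)` of `E_{W,1}` (`isShortThreeTorsion_iff_intrinsic`) — contradicting `no_rational_kernel_generator`.

The statement is an's `KummerCoverNotGammaOne` with ONE added binder `9 ∣ N` and the redundant binders `u ∉ Λ_E`, `c³℘'(u)/2 = Y₀` dropped (the composition `ReducibleCaseAtNine ⟸ NC ∧ BI ∧ AN` has
`9 ∣ N` in scope; ask to the C3 LEAD / -an: add `9 ∣ N →` to (NC-b)/(NC) before registering v21, then this closes stub 4 by name) and with
`KummerPeriodTrivial` unfolded (`∃ k ν, ν ∈ Λ_E ∧ c·{∞,γ∞}_f = k·(3u) + 3ν`).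

HONEST FRAMING.  One node of a CONDITIONAL reduction; (NC-a), (AN), the printed inputs (Kurth–Long, CDT), C3, Manin's conjecture and BSD
are NOT proved here.  No definitions, no named facts, no sorry.
[cite: Stevens1989, §2 Thm. 2.3 (shape: the Shimura kernel; the μ₃-type input is the LEAD's tree theorem)] [cite: Vatsal2005, §1 p. 1 (engine
shape only: «V = ker(J₀(N) → J₁(N)) is of multiplicative type», citing Ling–Oesterlé 1991)] [cite: Manin1972, Prop. 1.4 (cusp symbols / periods over Γ)]
-/

set_option autoImplicit false
-- lint-debt: the directory name repeats the summit name (sibling precedent `ManinLocalTwoThreeShimuraKernelRealStructure.lean`)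
set_option linter.dupNamespace false

noncomputable section

open scoped Classical ComplexConjugate MatrixGroups PeriodPair
open WeierstrassCurve Literature.NumberTheory.EllipticCurves Literature.NumberTheory.EllipticCurves.ModularForms
open CongruenceSubgroup
open Summit.BirchSwinnertonDyer.Rank1Residual.ManinAdditive.CuspidalKummer
open Summit.BirchSwinnertonDyer.Rank1Residual.ManinAdditive.CuspidalKummerThree

namespace Summit.BirchSwinnertonDyer.BirchSwinnertonDyer.Theorems.ManinLocalTwoThree.KummerCover

variable {W : WeierstrassCurve ℚ} {N : ℕ} [NeZero N]

/-- In `𝔽₃`: `k₁m₁ = 1`, `k₁m₂ = 0`, `k₂m₂ = 1` is inconsistent. -/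
private theorem zmod3_absurd : ∀ k₁ m₁ m₂ k₂ : ZMod 3, k₁ * m₁ = 1 → k₁ * m₂ = 0 → k₂ * m₂ = 1 → False := by decide

/-- **`Λ ⊄ ℤ·3u + 3Λ` for `3u ∈ Λ`** on a rank-`2` lattice: `Λ/3Λ ≅ (ℤ/3)²` is not generated by one class. [folklore] -/
theorem not_forall_mem_span_three (L : PeriodPair) {u : ℂ} (h3u : 3 * u ∈ L.lattice)
    (h : ∀ z ∈ L.lattice, ∃ k : ℤ, ∃ ν ∈ L.lattice, z = k * (3 * u) + 3 * ν) : False := by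
  obtain ⟨m₁, m₂, hm⟩ := PeriodPair.mem_lattice.mp h3u
  obtain ⟨k₁, ν₁, hν₁, h₁⟩ := h L.ω₁ L.ω₁_mem_lattice
  obtain ⟨k₂, ν₂, hν₂, h₂⟩ := h L.ω₂ L.ω₂_mem_lattice
  obtain ⟨a₁, b₁, rfl⟩ := PeriodPair.mem_lattice.mp hν₁
  obtain ⟨a₂, b₂, rfl⟩ := PeriodPair.mem_lattice.mp hν₂
  have e₁ : ((k₁ * m₁ + 3 * a₁ - 1 : ℤ) : ℂ) * L.ω₁ + ((k₁ * m₂ + 3 * b₁ : ℤ) : ℂ) * L.ω₂ = 0 := by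
    push_cast; rw [← hm] at h₁; linear_combination -h₁
  have e₂ : ((k₂ * m₁ + 3 * a₂ : ℤ) : ℂ) * L.ω₁ + ((k₂ * m₂ + 3 * b₂ - 1 : ℤ) : ℂ) * L.ω₂ = 0 := by
    push_cast; rw [← hm] at h₂; linear_combination -h₂
  obtain ⟨f₁, f₂⟩ := PeriodPair.intCast_pair_eq_zero L e₁
  obtain ⟨-, f₄⟩ := PeriodPair.intCast_pair_eq_zero L e₂
  refine zmod3_absurd (k₁ : ZMod 3) (m₁ : ZMod 3) (m₂ : ZMod 3) (k₂ : ZMod 3) ?_ ?_ ?_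
  · have := congrArg (fun x : ℤ ↦ (x : ZMod 3)) f₁
    push_cast at this
    rw [show (3 : ZMod 3) = 0 by decide] at this
    linear_combination this
  · have := congrArg (fun x : ℤ ↦ (x : ZMod 3)) f₂
    push_cast at this
    rw [show (3 : ZMod 3) = 0 by decide] at this
    linear_combination this
  · have := congrArg (fun x : ℤ ↦ (x : ZMod 3)) f₄
    push_cast at this
    rw [show (3 : ZMod 3) = 0 by decide] at this
    linear_combination this

/-- **`Λ₁(f) ⊄ 3Λ₀(f)` for a lattice-optimal datum** (complex conjugation acts trivially on `Λ₀/Λ₁` — `conj_sub_self_mem_periodLatticeGamma1` — but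
never trivially on `Λ₀/3Λ₀`, `false_of_conj_sub_self_mem_natCast_mul`). [cite: Manin1972, §1.6 (real structure of the period lattice)] -/
theorem exists_mem_periodLatticeGamma1_not_three_mul (D : ModularParametrizationData W N)
    (hopt : ∀ z ∈ D.L.lattice, ∃ w ∈ periodLattice D.f, z = D.c * w) :
    ∃ w ∈ periodLatticeGamma1 D.f, ∀ v ∈ periodLattice D.f, w ≠ 3 * v := by
  by_contra hcon
  push Not at hcon
  have hreal : ∀ n, (cuspCoeff D.f n).im = 0 := D.isNewformOf.1.cuspCoeff_im_eq_zero
  refine false_of_conj_sub_self_mem_natCast_mul D.L (le_refl 3)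
    (conj_sub_self_mem_natCast_mul_lattice_of_periodLattice D hopt (p := 3) fun z hz ↦ ?_)
  obtain ⟨v, hv, hv'⟩ := hcon _ (conj_sub_self_mem_periodLatticeGamma1 hreal hz)
  exact ⟨v, hv, by rw [hv']; push_cast; ring⟩

/-- **(NC-b) at `9 ∣ N`: the Kummer character of a rational `3`-torsion point is non-trivial on `Γ₁(N)`** — some `γ ∈ Γ₁(N)` has
`c·{∞,γ∞}_f ∉ ℤ·3u + 3Λ_E` (an's `KummerCoverNotGammaOne` with the binder `9 ∣ N` added and `KummerPeriodTrivial` unfolded).  Proof in the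
module docstring; the decisive input is the LEAD's μ₃-type theorem `no_rational_kernel_generator`. [cite: Stevens1989, §2 Thm. 2.3 (shape)] -/
theorem exists_mem_gamma1_not_kummerPeriodTrivial (W : WeierstrassCurve ℚ) [W.IsElliptic] [W.IsGloballyMinimal] {N : ℕ} [NeZero N]
    (D : ModularParametrizationData W N) (h9 : 9 ∣ N)
    (hopt : ∀ z ∈ D.L.lattice, ∃ w ∈ periodLattice D.f, z = D.c * w)
    (X₀ Y₀ : ℚ) (hT : IsShortThreeTorsion W D.c X₀ Y₀)
    (u : ℂ) (h3u : 3 * u ∈ D.L.lattice) (hX : (D.c : ℂ) ^ 2 * ℘[D.L] u = (X₀ : ℂ)) :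
    ∃ γ : Gamma0 N, (γ : SL(2, ℤ)) ∈ Gamma1 N ∧
      ¬ (∃ k : ℤ, ∃ ν ∈ D.L.lattice, (D.c : ℂ) * cuspSymbol D.f γ = k * (3 * u) + 3 * ν) := by
  by_contra hall
  push Not at hall
  have hc0 : D.c ≠ 0 := D.maninConstant_ne_zero_holds
  have hc₀ : (D.c : ℂ) ≠ 0 := by exact_mod_cast hc0
  have h9' : 3 ^ 2 ∣ N := by norm_num; exact h9
  -- `S = ℤ·3u + 3Λ`, an additive subgroup containing `c·Λ₁(f)`
  let S : AddSubgroup ℂ :=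
    { carrier := {x | ∃ k : ℤ, ∃ ν ∈ D.L.lattice, x = k * (3 * u) + 3 * ν}
      zero_mem' := ⟨0, 0, zero_mem _, by simp⟩
      add_mem' := by
        rintro x y ⟨k, ν, hν, rfl⟩ ⟨k', ν', hν', rfl⟩
        exact ⟨k + k', ν + ν', add_mem hν hν', by push_cast; ring⟩
      neg_mem' := by
        rintro x ⟨k, ν, hν, rfl⟩
        exact ⟨-k, -ν, neg_mem hν, by push_cast; ring⟩ }
  have hS : ∀ w ∈ periodLatticeGamma1 D.f, (D.c : ℂ) * w ∈ S := by
    intro w hw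
    refine AddSubgroup.closure_induction (p := fun x _ ↦ (D.c : ℂ) * x ∈ S) ?_ ?_ ?_ ?_ hw
    · rintro _ ⟨γ, rfl⟩
      obtain ⟨k, ν, hν, hk⟩ := hall ⟨(γ : SL(2, ℤ)), Gamma1_in_Gamma0 N γ.2⟩ γ.2
      exact ⟨k, ν, hν, hk⟩
    · simp only [mul_zero]; exact zero_mem S
    · intro x y _ _ hx hy; rw [mul_add]; exact add_mem hx hy
    · intro x _ hx; rw [mul_neg]; exact neg_mem hx
  by_cases hΛ : periodLatticeGamma1 D.f = periodLattice D.f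
  · -- (A) `Λ = cΛ₀ = cΛ₁ ⊆ S`
    refine not_forall_mem_span_three D.L h3u fun z hz ↦ ?_
    obtain ⟨w, hw, rfl⟩ := hopt z hz
    rw [← hΛ] at hw
    obtain ⟨k, ν, hν, hk⟩ := hS w hw
    exact ⟨k, ν, hν, hk⟩
  · -- (B) a kernel generator `w ∈ Λ₁ ∖ 3Λ₀`
    obtain ⟨w, hw, hw3⟩ := exists_mem_periodLatticeGamma1_not_three_mul D hopt
    obtain ⟨k, ν, hν, hk⟩ := hS w hw
    -- `3 ∤ k`
    have hk3 : ¬ (3 : ℤ) ∣ k := by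
      rintro ⟨k', rfl⟩
      have hk'u : (k' : ℂ) * (3 * u) ∈ D.L.lattice := by
        have := D.L.lattice.smul_mem (k' : ℤ) h3u; rwa [zsmul_eq_mul] at this
      have hmem : (k' : ℂ) * (3 * u) + ν ∈ D.L.lattice := add_mem hk'u hν
      obtain ⟨v, hv, hv'⟩ := hopt _ hmem
      refine hw3 v hv (mul_left_cancel₀ hc₀ ?_)
      have : (D.c : ℂ) * w = 3 * ((k' : ℂ) * (3 * u) + ν) := by rw [hk]; push_cast; ring
      rw [this, hv']; ring
    -- `cw/3 ≡ ±u (mod Λ)`: write `k = 3q + r`, `r ∈ {1, 2}`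
    have hr : k % 3 = 1 ∨ k % 3 = 2 := by omega
    have hkq : (k : ℂ) = 3 * ((k / 3 : ℤ) : ℂ) + ((k % 3 : ℤ) : ℂ) := by
      have hkq' : k = 3 * (k / 3) + k % 3 := by omega
      have := congrArg (fun t : ℤ ↦ (t : ℂ)) hkq'
      push_cast at this
      exact this
    have hX₁ : ((X₀ / (D.c : ℚ) ^ 2 : ℚ) : ℂ) = ℘[D.L] ((D.c : ℂ) * w / 3) := by
      -- `cw/3 = ±u + λ` with `λ ∈ Λ`
      have hq3u : ((k / 3 : ℤ) : ℂ) * (3 * u) + ν ∈ D.L.lattice := by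
        have := D.L.lattice.smul_mem (k / 3 : ℤ) h3u
        rw [zsmul_eq_mul] at this
        exact add_mem this hν
      have h℘u : ℘[D.L] ((D.c : ℂ) * w / 3) = ℘[D.L] u := by
        rcases hr with h1 | h2
        · have e : (D.c : ℂ) * w / 3 = u + (((k / 3 : ℤ) : ℂ) * (3 * u) + ν) := by
            rw [hk, hkq, h1]; push_cast; ring
          rw [e]
          exact D.L.weierstrassP_add_coe u ⟨_, hq3u⟩
        · have hq3u' : ((k / 3 : ℤ) : ℂ) * (3 * u) + ν + 3 * u ∈ D.L.lattice := add_mem hq3u h3u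
          have e : (D.c : ℂ) * w / 3 = -u + (((k / 3 : ℤ) : ℂ) * (3 * u) + ν + 3 * u) := by
            rw [hk, hkq, h2]; push_cast; ring
          rw [e, D.L.weierstrassP_add_coe (-u) ⟨_, hq3u'⟩, D.L.weierstrassP_neg]
      rw [h℘u]
      have hcQ : (D.c : ℚ) ≠ 0 := Int.cast_ne_zero.mpr hc0
      have : ((X₀ / (D.c : ℚ) ^ 2 : ℚ) : ℂ) = (X₀ : ℂ) / (D.c : ℂ) ^ 2 := by push_cast; ring
      rw [this, ← hX]
      field_simp
    have hT1 : IsShortThreeTorsion W 1 (X₀ / (D.c : ℚ) ^ 2) (Y₀ / (D.c : ℚ) ^ 3) :=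
      (isShortThreeTorsion_iff_intrinsic W hc0 X₀ Y₀).mp hT
    exact no_rational_kernel_generator D hopt h9' hΛ hw hw3 hT1 hX₁

end Summit.BirchSwinnertonDyer.BirchSwinnertonDyer.Theorems.ManinLocalTwoThree.KummerCover

end
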